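import Summits.BirchSwinnertonDyer.BirchSwinnertonDyer.Theorems.QuadraticBranchSignedControlPlusEtaNonsurjThetaFunctionalEquation
import Literature.NumberTheory.EllipticCurves.IwasawaAlgebraInvolution
import HarnessLib

/-!
# Route `QuadraticBranchSignedControl` (rung K8, cell `bsd-potss`), residual crux `PlusEtaMainConjectureNonsurj`
# (stmt-BirchSwinnertonDyer-19606): THE FUNCTIONAL EQUATION OF `θ_n(η)` ON THE QUADRATIC BRANCH, II —
# the element-level equation in `ℚ[T]/ω_n` and its `Λ`-adic form `ι Θ_n ≡ w (1+T)^{s_N} Θ_n (mod ω_n Λ)`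
# (seat `bsd-potss-k8eta-c2` g27; kernel tool; sequel of `…ThetaFunctionalEquation`)

WHY. Part I (`…ThetaFunctionalEquation`, p759560) proved the functional equation of the quadratic-branch
Mazur–Tate elements at the level of their COEFFICIENTS: `B_n(s) = w · B_n(−s_N − s)` with
`θ_n(f, η, T) = ∑_{s mod pⁿ} B_n(s)(1+T)^s`, `N ≡ η_N γ^{s_N}`, `w = σ η(−1) η(η_N) = σ (−N | p)` (`σ` the Fricke
sign of `f`; for the newform of `V`, `w = w(V ⊗ η)`). This file turns it into the two forms the lineage's
`Λ`-adic instruments consume: (§6) in `ℚ[T]`,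
`ω_n ∣ θ_n(η)^{rev} − w (1+T)^{s_N} θ_n(η)` with `θ_n(η)^{rev} = ∑_s B_n(s) (1+T)^{(−s) mod pⁿ}` the image of
`θ_n(η)` under `σ_a ↦ σ_a⁻¹` in `ℚ[Γ_n] = ℚ[T]/ω_n`, `ω_n = (1+T)^{pⁿ} − 1`; (§7) in `Λ = ℤ_p⟦T⟧` with the
tree's Iwasawa involution `ι = IwasawaAlgebra.invol p` (`T ↦ (1+T)⁻¹ − 1`): for an INTEGRAL LIFT `Θ_n ∈ ℤ_p[T]`
of `θ_n(η)` (the lineage's standard interface, `exists_map_eq_map_quadraticBranchMazurTateElement`),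
`ι Θ_n − w (1+T)^{s_N} Θ_n ∈ ω_n Λ`. This is the input of the parity law for the `λ`-invariants of both signed
`p`-adic `L`-functions `L_p^±(V, η, X)` (sequel), exactly as Kim's ALGEBRAIC functional equation
(`Kim2008.thm311_etaSignedSelmerDual_charIdeal_map_invol`, a named fact) is the input of k8eta-c1's FE-squeeze on
the Selmer side — but here on the analytic side and PROVED.

MATHEMATICS. §6: regroup the definition by the exponent of `1+T`; reindex the reversed sum along the
involution `s ↦ −s_N − s` of `ℤ/pⁿ`, apply Part I's coefficient symmetry, and use
`(1+T)^a ≡ (1+T)^b (mod ω_n)` for `a ≡ b (mod pⁿ)`. §7: the coefficients `B_n(s)` are `p`-integral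
(`norm_branchSymbol_div_pow_le_one`: `p` odd, `p ∤ N`, `a_p = 0`), so `Θ_n := ∑_s B̃_n(s)(1+T)^s ∈ ℤ_p[T]`
lifts `θ_n(η)`; the divisibility of §6 descends from `ℚ_p[T]` to `ℤ_p[T]` because `ω_n` is MONIC and the base
change is injective (Mathlib `Polynomial.map_dvd_map`); and in `Λ`, `ι Θ_n = ∑_s B̃_n(s)(1+T)^{−s}`
(`ι(1+T) = (1+T)⁻¹`, tree `invol_one_add_X`) differs from the reversed element by
`∑_s B̃_n(s)((1+T)^{−s} − (1+T)^{pⁿ−s}) = −(∑_{s≠0} B̃_n(s)(1+T)^{−s}) · ω_n ∈ ω_n Λ`.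

WHAT. §6 `quadraticBranchMazurTateElement_eq_sum_coeffSum`, **`cyclotomicOmega_dvd_reverse_sub_sign_mul`**;
§7 `norm_coeffSum_le_one`, `map_lift_eq_map_quadraticBranchMazurTateElement`,
`cyclotomicOmega_dvd_reverse_sub_sign_mul_lift` (in `ℤ_p[T]`), `cyclotomicOmega_dvd_invol_sub_reverse` (pure `Λ`),
**`exists_lift_invol_sub_sign_mul_eq_omega_mul`** (`∃ Θ q, Θ ↦ θ_n(η) ∧ ι Θ − w(1+T)^{s_N}Θ = ω_n q`).

HONEST FRAMING (cell `bsd-potss`; FULL-BSD rank ≤ 1 programme, HUMAN RULING D-0036/D-0074): TOOL THEOREMS ONLY —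
no definition, no named fact, no `sorry`, axioms standard; nothing about (A), (C1⁺_η), C-cc-1 or `BSD(W,p)` of
any pair is claimed; no stub of 19606 is proved; crux and route OPEN; nothing booked.
`--supports stmt-BirchSwinnertonDyer-19606`.

References: [MazurTateTeitelbaum1986Invent] §I.13, §I.17; [Kobayashi2003] §3 (p. 6), (3.4)–(3.5);
[Washington1997] §7.1, §13.2; [Pollack2003] Thm. 5.6, Thm. 6.17. Tree: Part I (p759560),
`IwasawaAlgebraInvolution.lean`, `PlusMinusPAdicLFunction{,Proofs}.lean` (`cyclotomicOmega`, `monic_cyclotomicOmega`).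
-/

set_option autoImplicit false
set_option linter.dupNamespace false
noncomputable section

open scoped Classical MatrixGroups ModularForm

open CongruenceSubgroup Polynomial Literature.NumberTheory.EllipticCurves
  Literature.NumberTheory.EllipticCurves.ModularForms
open Summit.BirchSwinnertonDyer.Rank1Residual.Additive

namespace Summit.BirchSwinnertonDyer.BirchSwinnertonDyer.Theorems.EtaThetaFunctionalEquation

variable {p : ℕ} [hp : Fact p.Prime]

/-! ## §6 The functional equation of `θ_n(η)` in `ℚ[T]`, modulo `ω_n = (1+T)^{pⁿ} − 1` -/

section Rational

variable {N : ℕ} [NeZero N] {f : CuspForm (Gamma0 N) 2}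

omit [NeZero N] in
/-- **`θ_n(η) = ∑_{s mod pⁿ} B_n(s) (1+T)^s`** with `B_n(s) = ∑_{w ∈ μ_{p−1}} η(w)[wγ^s/p^{n+e₀}]^δ_f`
(regrouping the tree's definition `quadraticBranchMazurTateElement` by the exponent of `1 + T`).
[cite: Kobayashi2003, §3 (p. 6) and (3.4)–(3.5)] -/
theorem quadraticBranchMazurTateElement_eq_sum_coeffSum (n : ℕ) [Fintype (rootsOfUnity (torsionOrder p) ℤ_[p])] :
    quadraticBranchMazurTateElement p f n =
      ∑ s : ZMod (p ^ n), C (∑ w : rootsOfUnity (torsionOrder p) ℤ_[p], (teichSign p w : ℚ) * branchSymbol p f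
        (((PadicInt.toZModPow (n + cyclotomicExponent p) ((w : ℤ_[p]ˣ) : ℤ_[p]) *
            (cyclotomicGenerator p : ZMod (p ^ (n + cyclotomicExponent p))) ^ s.val).val : ℚ) /
          (p : ℚ) ^ (n + cyclotomicExponent p))) * (X + 1) ^ s.val := by
  rw [quadraticBranchMazurTateElement, finsum_eq_sum_of_fintype, Finset.sum_comm]
  refine Finset.sum_congr rfl fun s _ ↦ ?_
  rw [map_sum, Finset.sum_mul]

/-- **The functional equation of `θ_n(η)` modulo `ω_n`** (Mazur–Tate–Teitelbaum §I.17 on the quadratic branch):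
with `B_n` as above, `w_N f = −σ f`, `N ≡ η_N γ^{s_N} (mod p^{n+e₀})` and the sign
`w = σ η(−1) η(η_N)` (`= σ (−N | p)`, `sign_eq_mul_legendreSym_neg`),
`ω_n ∣ ∑_s B_n(s) (1+T)^{(−s) mod pⁿ} − w (1+T)^{s_N} θ_n(η)` in `ℚ[T]` — i.e. `θ_n(η)^ι ≡ w (1+T)^{s_N} θ_n(η)`
in `ℚ[T]/ω_n = ℚ[Γ_n]`, `ι : (1+T) ↦ (1+T)⁻¹`. Reindex the reversed sum along `s ↦ −s_N − s`, use the
coefficient symmetry `coeffSum_eq_sign_mul_coeffSum`, and `(1+T)^{(s_N+s) mod pⁿ} ≡ (1+T)^{s_N}(1+T)^{s}`.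
[cite: MazurTateTeitelbaum1986Invent, §I.17] -/
theorem cyclotomicOmega_dvd_reverse_sub_sign_mul (hp2 : p ≠ 2) {σ : ℤ} (hσ : σ ^ 2 = 1)
    (hW : atkinLehnerInvolution N 2 N f = (-(σ : ℂ)) • f) (n : ℕ)
    [Fintype (rootsOfUnity (torsionOrder p) ℤ_[p])]
    {ηN : rootsOfUnity (torsionOrder p) ℤ_[p]} {sN : ZMod (p ^ n)}
    (hν : PadicInt.toZModPow (n + cyclotomicExponent p) ((ηN : ℤ_[p]ˣ) : ℤ_[p]) *
        (cyclotomicGenerator p : ZMod (p ^ (n + cyclotomicExponent p))) ^ sN.val =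
          (N : ZMod (p ^ (n + cyclotomicExponent p)))) :
    (cyclotomicOmega p n).map (Int.castRingHom ℚ) ∣
      (∑ s : ZMod (p ^ n), C (∑ w : rootsOfUnity (torsionOrder p) ℤ_[p], (teichSign p w : ℚ) * branchSymbol p f
        (((PadicInt.toZModPow (n + cyclotomicExponent p) ((w : ℤ_[p]ˣ) : ℤ_[p]) *
            (cyclotomicGenerator p : ZMod (p ^ (n + cyclotomicExponent p))) ^ s.val).val : ℚ) /
          (p : ℚ) ^ (n + cyclotomicExponent p))) * (X + 1) ^ (-s).val) -
      C ((σ * teichSign p ⟨-1, neg_one_mem_rootsOfUnity_torsionOrder p⟩ * teichSign p ηN : ℤ) : ℚ) *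
        (X + 1) ^ sN.val * quadraticBranchMazurTateElement p f n := by
  haveI : NeZero (p ^ n) := ⟨pow_ne_zero _ hp.out.ne_zero⟩
  -- abbreviations
  set w : ℤ := σ * teichSign p ⟨-1, neg_one_mem_rootsOfUnity_torsionOrder p⟩ * teichSign p ηN with hw
  set B : ZMod (p ^ n) → ℚ := fun s ↦ ∑ w : rootsOfUnity (torsionOrder p) ℤ_[p],
      (teichSign p w : ℚ) * branchSymbol p f
        (((PadicInt.toZModPow (n + cyclotomicExponent p) ((w : ℤ_[p]ˣ) : ℤ_[p]) *
            (cyclotomicGenerator p : ZMod (p ^ (n + cyclotomicExponent p))) ^ s.val).val : ℚ) /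
          (p : ℚ) ^ (n + cyclotomicExponent p)) with hB
  have hsym : ∀ s : ZMod (p ^ n), B (-sN - s) = w * B s := by
    intro s
    have h := coeffSum_eq_sign_mul_coeffSum hp2 hσ hW n hν (-sN - s)
    simp only [hB]
    rw [h, sub_sub_cancel, ← hw]
  set ω : ℚ[X] := (cyclotomicOmega p n).map (Int.castRingHom ℚ) with hω
  have hωeq : ω = (X + 1) ^ p ^ n - 1 := by
    rw [hω, cyclotomicOmega, Polynomial.map_sub, Polynomial.map_pow, Polynomial.map_add, Polynomial.map_X,
      Polynomial.map_one]
  -- `(X+1)^a ≡ (X+1)^b mod ω` whenever `a ≡ b mod pⁿ`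
  have hpow : ∀ a b : ℕ, a % p ^ n = b % p ^ n → ω ∣ (X + 1 : ℚ[X]) ^ a - (X + 1) ^ b := by
    intro a b hab
    have key : ∀ c : ℕ, ω ∣ (X + 1 : ℚ[X]) ^ c - (X + 1) ^ (c % p ^ n) := by
      intro c
      have hc : (X + 1 : ℚ[X]) ^ c = (X + 1) ^ (c % p ^ n) * ((X + 1) ^ p ^ n) ^ (c / p ^ n) := by
        rw [← pow_mul, ← pow_add, Nat.mod_add_div]
      rw [hc, ← mul_sub_one, hωeq]
      refine Dvd.dvd.mul_left ?_ _
      have h := sub_dvd_pow_sub_pow ((X + 1 : ℚ[X]) ^ p ^ n) 1 (c / p ^ n)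
      rwa [one_pow] at h
    have := (key a).sub (key b)
    rwa [hab, sub_sub_sub_cancel_right] at this
  rw [quadraticBranchMazurTateElement_eq_sum_coeffSum n, Finset.mul_sum]
  -- reindex the reversed sum along the involution `s ↦ -sN - s`
  have hinv : Function.Involutive (fun s : ZMod (p ^ n) ↦ -sN - s) := fun s ↦ by ring
  rw [← Fintype.sum_bijective _ hinv.bijective (fun s ↦ C (B (-sN - s)) * (X + 1) ^ (-(-sN - s)).val)
    (fun s ↦ C (B s) * (X + 1) ^ (-s).val) (fun s ↦ rfl), ← Finset.sum_sub_distrib]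
  refine Finset.dvd_sum fun s _ ↦ ?_
  rw [hsym s, neg_sub, sub_neg_eq_add, show C ((w : ℚ) * B s) * (X + 1 : ℚ[X]) ^ (s + sN).val -
      C ((w : ℤ) : ℚ) * (X + 1) ^ sN.val * (C (B s) * (X + 1) ^ s.val) =
      C ((w : ℚ) * B s) * ((X + 1) ^ (s + sN).val - (X + 1) ^ (sN.val + s.val)) by
    rw [map_mul]; ring]
  refine Dvd.dvd.mul_left (hpow _ _ ?_) _
  rw [ZMod.val_add, Nat.mod_mod, add_comm]

end Rational

/-! ## §7 The `Λ`-adic form: `ι Θ_n ≡ w (1+T)^{s_N} Θ_n (mod ω_n)` for an integral lift `Θ_n ∈ ℤ_p[T]` of `θ_n(η)` -/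

section Lambda

variable {N : ℕ} [NeZero N] {f : CuspForm (Gamma0 N) 2}

open Literature.NumberTheory.EllipticCurves.IwasawaAlgebra

/-- **`p`-integrality of the coefficients `B_n(s)`** (`p` odd, `p ∤ N`, `a_p = 0`: `η(w) = ±1` and the branch
symbols `[a/p^k]^δ_f` are `p`-integral, `norm_branchSymbol_div_pow_le_one`; ultrametric inequality for the sum).
[cite: Pollack2003, Thm. 5.6] -/
theorem norm_coeffSum_le_one (hp2 : p ≠ 2) (hf0 : IsNewform0 f) (hQ : coeffField f = ⊥) (hpN : ¬ p ∣ N)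
    (hap : cuspCoeff f p = ((0 : ℤ) : ℂ)) (n : ℕ) [Fintype (rootsOfUnity (torsionOrder p) ℤ_[p])]
    (s : ZMod (p ^ n)) :
    ‖algebraMap ℚ ℚ_[p] (∑ w : rootsOfUnity (torsionOrder p) ℤ_[p], (teichSign p w : ℚ) * branchSymbol p f
        (((PadicInt.toZModPow (n + cyclotomicExponent p) ((w : ℤ_[p]ˣ) : ℤ_[p]) *
            (cyclotomicGenerator p : ZMod (p ^ (n + cyclotomicExponent p))) ^ s.val).val : ℚ) /
          (p : ℚ) ^ (n + cyclotomicExponent p)))‖ ≤ 1 := by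
  rw [map_sum]
  refine IsUltrametricDist.norm_sum_le_of_forall_le_of_nonneg zero_le_one fun w _ ↦ ?_
  rw [map_mul, norm_mul, eq_ratCast, eq_ratCast]
  have h1 : ‖((teichSign p w : ℚ) : ℚ_[p])‖ ≤ 1 := by
    rw [Rat.cast_intCast]; exact Padic.norm_int_le_one _
  have h2 := norm_branchSymbol_div_pow_le_one hp2 hf0 hQ hpN hap (k := n + cyclotomicExponent p)
    (a := (PadicInt.toZModPow (n + cyclotomicExponent p) ((w : ℤ_[p]ˣ) : ℤ_[p]) *
      (cyclotomicGenerator p : ZMod (p ^ (n + cyclotomicExponent p))) ^ s.val).val)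
  calc _ ≤ 1 * 1 := mul_le_mul h1 h2 (norm_nonneg _) zero_le_one
    _ = 1 := one_mul _

omit [NeZero N] in
/-- **An integral lift of `θ_n(η)`**: if `B̃ : ℤ/pⁿ → ℤ_p` lifts the coefficients `B_n(s)` then
`Θ = ∑_s B̃(s) (1+T)^s ∈ ℤ_p[T]` maps to `θ_n(η)` in `ℚ_p[T]`. [folklore] -/
theorem map_lift_eq_map_quadraticBranchMazurTateElement (n : ℕ) [Fintype (rootsOfUnity (torsionOrder p) ℤ_[p])]
    (Bt : ZMod (p ^ n) → ℤ_[p])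
    (hBt : ∀ s, ((Bt s : ℤ_[p]) : ℚ_[p]) = algebraMap ℚ ℚ_[p] (∑ w : rootsOfUnity (torsionOrder p) ℤ_[p],
      (teichSign p w : ℚ) * branchSymbol p f
        (((PadicInt.toZModPow (n + cyclotomicExponent p) ((w : ℤ_[p]ˣ) : ℤ_[p]) *
            (cyclotomicGenerator p : ZMod (p ^ (n + cyclotomicExponent p))) ^ s.val).val : ℚ) /
          (p : ℚ) ^ (n + cyclotomicExponent p)))) :
    (∑ s : ZMod (p ^ n), C (Bt s) * (X + 1) ^ s.val : ℤ_[p][X]).map (algebraMap ℤ_[p] ℚ_[p]) =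
      (quadraticBranchMazurTateElement p f n).map (algebraMap ℚ ℚ_[p]) := by
  rw [quadraticBranchMazurTateElement_eq_sum_coeffSum n, Polynomial.map_sum, Polynomial.map_sum]
  refine Finset.sum_congr rfl fun s _ ↦ ?_
  rw [Polynomial.map_mul, Polynomial.map_mul, Polynomial.map_pow, Polynomial.map_pow, Polynomial.map_add,
    Polynomial.map_add, Polynomial.map_X, Polynomial.map_X, Polynomial.map_one, Polynomial.map_one,
    Polynomial.map_C, Polynomial.map_C, PadicInt.algebraMap_apply, hBt]

/-- **The functional equation descends to `ℤ_p[T]`**: for an integral lift as above,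
`ω_n ∣ ∑_s B̃(s)(1+T)^{(−s) mod pⁿ} − w (1+T)^{s_N} ∑_s B̃(s)(1+T)^s` in `ℤ_p[T]` (`ω_n` is monic and
`ℤ_p[T] → ℚ_p[T]` is injective: Mathlib `Polynomial.map_dvd_map`). [cite: MazurTateTeitelbaum1986Invent, §I.17] -/
theorem cyclotomicOmega_dvd_reverse_sub_sign_mul_lift (hp2 : p ≠ 2) {σ : ℤ} (hσ : σ ^ 2 = 1)
    (hW : atkinLehnerInvolution N 2 N f = (-(σ : ℂ)) • f) (n : ℕ)
    [Fintype (rootsOfUnity (torsionOrder p) ℤ_[p])]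
    {ηN : rootsOfUnity (torsionOrder p) ℤ_[p]} {sN : ZMod (p ^ n)}
    (hν : PadicInt.toZModPow (n + cyclotomicExponent p) ((ηN : ℤ_[p]ˣ) : ℤ_[p]) *
        (cyclotomicGenerator p : ZMod (p ^ (n + cyclotomicExponent p))) ^ sN.val =
          (N : ZMod (p ^ (n + cyclotomicExponent p))))
    (Bt : ZMod (p ^ n) → ℤ_[p])
    (hBt : ∀ s, ((Bt s : ℤ_[p]) : ℚ_[p]) = algebraMap ℚ ℚ_[p] (∑ w : rootsOfUnity (torsionOrder p) ℤ_[p],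
      (teichSign p w : ℚ) * branchSymbol p f
        (((PadicInt.toZModPow (n + cyclotomicExponent p) ((w : ℤ_[p]ˣ) : ℤ_[p]) *
            (cyclotomicGenerator p : ZMod (p ^ (n + cyclotomicExponent p))) ^ s.val).val : ℚ) /
          (p : ℚ) ^ (n + cyclotomicExponent p)))) :
    (cyclotomicOmega p n).map (Int.castRingHom ℤ_[p]) ∣
      (∑ s : ZMod (p ^ n), C (Bt s) * (X + 1) ^ (-s).val : ℤ_[p][X]) -
        C (((σ * teichSign p ⟨-1, neg_one_mem_rootsOfUnity_torsionOrder p⟩ * teichSign p ηN : ℤ) : ℤ_[p])) *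
          (X + 1) ^ sN.val * ∑ s : ZMod (p ^ n), C (Bt s) * (X + 1) ^ s.val := by
  set w : ℤ := σ * teichSign p ⟨-1, neg_one_mem_rootsOfUnity_torsionOrder p⟩ * teichSign p ηN with hw
  have hωmap : ((cyclotomicOmega p n).map (Int.castRingHom ℤ_[p])).map (algebraMap ℤ_[p] ℚ_[p]) =
      ((cyclotomicOmega p n).map (Int.castRingHom ℚ)).map (algebraMap ℚ ℚ_[p]) := by
    rw [Polynomial.map_map, Polynomial.map_map]
    congr 1
  have hRmap : ((∑ s : ZMod (p ^ n), C (Bt s) * (X + 1) ^ (-s).val : ℤ_[p][X]) -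
      C (w : ℤ_[p]) * (X + 1) ^ sN.val * ∑ s : ZMod (p ^ n), C (Bt s) * (X + 1) ^ s.val).map
        (algebraMap ℤ_[p] ℚ_[p]) =
      ((∑ s : ZMod (p ^ n), C (∑ w : rootsOfUnity (torsionOrder p) ℤ_[p], (teichSign p w : ℚ) * branchSymbol p f
        (((PadicInt.toZModPow (n + cyclotomicExponent p) ((w : ℤ_[p]ˣ) : ℤ_[p]) *
            (cyclotomicGenerator p : ZMod (p ^ (n + cyclotomicExponent p))) ^ s.val).val : ℚ) /
          (p : ℚ) ^ (n + cyclotomicExponent p))) * (X + 1) ^ (-s).val) -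
      C ((w : ℤ) : ℚ) * (X + 1) ^ sN.val * quadraticBranchMazurTateElement p f n).map (algebraMap ℚ ℚ_[p]) := by
    have hsum : ((∑ s : ZMod (p ^ n), C (Bt s) * (X + 1) ^ (-s).val : ℤ_[p][X])).map (algebraMap ℤ_[p] ℚ_[p]) =
        (∑ s : ZMod (p ^ n), C (∑ w : rootsOfUnity (torsionOrder p) ℤ_[p], (teichSign p w : ℚ) * branchSymbol p f
          (((PadicInt.toZModPow (n + cyclotomicExponent p) ((w : ℤ_[p]ˣ) : ℤ_[p]) *
              (cyclotomicGenerator p : ZMod (p ^ (n + cyclotomicExponent p))) ^ s.val).val : ℚ) /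
            (p : ℚ) ^ (n + cyclotomicExponent p))) * (X + 1) ^ (-s).val).map (algebraMap ℚ ℚ_[p]) := by
      rw [Polynomial.map_sum, Polynomial.map_sum]
      refine Finset.sum_congr rfl fun s _ ↦ ?_
      rw [Polynomial.map_mul, Polynomial.map_mul, Polynomial.map_pow, Polynomial.map_pow, Polynomial.map_add,
        Polynomial.map_add, Polynomial.map_X, Polynomial.map_X, Polynomial.map_one, Polynomial.map_one,
        Polynomial.map_C, Polynomial.map_C, PadicInt.algebraMap_apply, hBt]
    rw [Polynomial.map_sub, Polynomial.map_sub, Polynomial.map_mul, Polynomial.map_mul, Polynomial.map_mul,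
      Polynomial.map_mul, map_lift_eq_map_quadraticBranchMazurTateElement n Bt hBt, hsum,
      Polynomial.map_pow, Polynomial.map_pow, Polynomial.map_add, Polynomial.map_add,
      Polynomial.map_X, Polynomial.map_X, Polynomial.map_one, Polynomial.map_one, Polynomial.map_C,
      Polynomial.map_C]
    simp only [map_intCast]
  rw [← Polynomial.map_dvd_map (algebraMap ℤ_[p] ℚ_[p]) (FaithfulSMul.algebraMap_injective ℤ_[p] ℚ_[p])
    ((monic_cyclotomicOmega p n).map _), hωmap, hRmap]
  exact Polynomial.map_dvd (algebraMap ℚ ℚ_[p]) (cyclotomicOmega_dvd_reverse_sub_sign_mul hp2 hσ hW n hν)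

omit hp in
/-- **`ω_n ∣ ι Θ − Θ^{rev}` in `Λ`**: for `Θ = ∑_s b_s (1+T)^s` and its reversal `Θ^{rev} = ∑_s b_s (1+T)^{(−s) mod pⁿ}`,
`ι Θ = ∑_s b_s (1+T)^{−s}` (`ι(1+T) = (1+T)⁻¹`) and `(1+T)^{pⁿ−s} − (1+T)^{−s} = (1+T)^{−s} ω_n`.
[cite: Washington1997, §13.2] -/
theorem cyclotomicOmega_dvd_invol_sub_reverse [Fact p.Prime] (n : ℕ) (b : ZMod (p ^ n) → ℤ_[p]) :
    (((cyclotomicOmega p n).map (Int.castRingHom ℤ_[p]) : ℤ_[p][X]) : PowerSeries ℤ_[p]) ∣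
      invol p ((∑ s : ZMod (p ^ n), C (b s) * (X + 1) ^ s.val : ℤ_[p][X]) : PowerSeries ℤ_[p]) -
        ((∑ s : ZMod (p ^ n), C (b s) * (X + 1) ^ (-s).val : ℤ_[p][X]) : PowerSeries ℤ_[p]) := by
  haveI : NeZero (p ^ n) := ⟨pow_ne_zero _ (Fact.out : p.Prime).ne_zero⟩
  set U : IwasawaAlgebra p := 1 + PowerSeries.X with hU
  set V : IwasawaAlgebra p := 1 + invSubOne p with hV
  have hUV : U * V = 1 := one_add_X_mul_one_add_invSubOne p
  have hcoe : ∀ P : ℤ_[p][X], ((P : ℤ_[p][X]) : PowerSeries ℤ_[p]) = Polynomial.coeToPowerSeries.ringHom P :=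
    fun P ↦ rfl
  have hωΛ : (((cyclotomicOmega p n).map (Int.castRingHom ℤ_[p]) : ℤ_[p][X]) : PowerSeries ℤ_[p]) = U ^ p ^ n - 1 := by
    rw [cyclotomicOmega, Polynomial.map_sub, Polynomial.map_pow, Polynomial.map_add, Polynomial.map_X,
      Polynomial.map_one, Polynomial.coe_sub, Polynomial.coe_pow, Polynomial.coe_add,
      Polynomial.coe_X, Polynomial.coe_one, hU, add_comm]
  have hterm : ∀ (c : ℤ_[p]) (k : ℕ), ((C c * (X + 1) ^ k : ℤ_[p][X]) : PowerSeries ℤ_[p]) = PowerSeries.C c * U ^ k := by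
    intro c k
    rw [Polynomial.coe_mul, Polynomial.coe_pow, Polynomial.coe_C, Polynomial.coe_add, Polynomial.coe_X,
      Polynomial.coe_one, hU, add_comm]
  have hΘ : ((∑ s : ZMod (p ^ n), C (b s) * (X + 1) ^ s.val : ℤ_[p][X]) : PowerSeries ℤ_[p]) =
      ∑ s : ZMod (p ^ n), PowerSeries.C (b s) * U ^ s.val := by
    rw [hcoe, map_sum]; exact Finset.sum_congr rfl fun s _ ↦ hterm _ _
  have hR : ((∑ s : ZMod (p ^ n), C (b s) * (X + 1) ^ (-s).val : ℤ_[p][X]) : PowerSeries ℤ_[p]) =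
      ∑ s : ZMod (p ^ n), PowerSeries.C (b s) * U ^ (-s).val := by
    rw [hcoe, map_sum]; exact Finset.sum_congr rfl fun s _ ↦ hterm _ _
  have hιΘ : invol p ((∑ s : ZMod (p ^ n), C (b s) * (X + 1) ^ s.val : ℤ_[p][X]) : PowerSeries ℤ_[p]) =
      ∑ s : ZMod (p ^ n), PowerSeries.C (b s) * V ^ s.val := by
    rw [hΘ, map_sum]
    refine Finset.sum_congr rfl fun s _ ↦ ?_
    rw [map_mul, map_pow, invol_C, hU, hV, invol_one_add_X]
  -- `U^{(−s) mod pⁿ} − V^{s} ∈ (U^{pⁿ} − 1)`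
  have hkey : ∀ s : ZMod (p ^ n), U ^ p ^ n - 1 ∣ V ^ s.val - U ^ (-s).val := by
    intro s
    by_cases hs : s = 0
    · rw [hs, neg_zero, ZMod.val_zero, pow_zero, pow_zero, sub_self]; exact dvd_zero _
    · rw [ZMod.neg_val, if_neg hs]
      have hle : s.val ≤ p ^ n := (ZMod.val_lt s).le
      have h1 : U ^ (p ^ n - s.val) * (U * V) ^ s.val = V ^ s.val * U ^ p ^ n := by
        rw [mul_pow, ← mul_assoc, ← pow_add, Nat.sub_add_cancel hle]; ring
      rw [hUV, one_pow, mul_one] at h1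
      rw [h1]
      exact ⟨-V ^ s.val, by ring⟩
  rw [hιΘ, hR, hωΛ, ← Finset.sum_sub_distrib]
  refine Finset.dvd_sum fun s _ ↦ ?_
  rw [← mul_sub]
  exact Dvd.dvd.mul_left (hkey s) _

/-- **The functional equation in `Λ = ℤ_p⟦T⟧`.** For `p` odd, `p ∤ N`, `a_p(f) = 0`, `w_N f = −σ f` and
`N ≡ η_N γ^{s_N} (mod p^{n+e₀})`: there is an integral lift `Θ ∈ ℤ_p[T]` of `θ_n(f, η, T)` (its image in
`ℚ_p[T]` is that of `θ_n(η)`) and `q ∈ Λ` with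
`ι Θ − w (1+T)^{s_N} Θ = ω_n · q`, `ι : T ↦ (1+T)⁻¹ − 1` the Iwasawa involution (`IwasawaAlgebra.invol`),
`w = σ η(−1) η(η_N)` (`= σ (−N | p)`, `sign_eq_mul_legendreSym_neg`), `ω_n = (1+T)^{pⁿ} − 1`.
[cite: MazurTateTeitelbaum1986Invent, §I.17] [cite: Washington1997, §13.2] -/
theorem exists_lift_invol_sub_sign_mul_eq_omega_mul (hp2 : p ≠ 2) (hf0 : IsNewform0 f) (hQ : coeffField f = ⊥)
    (hpN : ¬ p ∣ N) (hap : cuspCoeff f p = ((0 : ℤ) : ℂ)) {σ : ℤ} (hσ : σ ^ 2 = 1)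
    (hW : atkinLehnerInvolution N 2 N f = (-(σ : ℂ)) • f) (n : ℕ)
    {ηN : rootsOfUnity (torsionOrder p) ℤ_[p]} {sN : ZMod (p ^ n)}
    (hν : PadicInt.toZModPow (n + cyclotomicExponent p) ((ηN : ℤ_[p]ˣ) : ℤ_[p]) *
        (cyclotomicGenerator p : ZMod (p ^ (n + cyclotomicExponent p))) ^ sN.val =
          (N : ZMod (p ^ (n + cyclotomicExponent p)))) :
    ∃ (Θ : ℤ_[p][X]) (q : IwasawaAlgebra p),
      Θ.map (algebraMap ℤ_[p] ℚ_[p]) = (quadraticBranchMazurTateElement p f n).map (algebraMap ℚ ℚ_[p]) ∧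
      invol p (Θ : PowerSeries ℤ_[p]) -
          PowerSeries.C (((σ * teichSign p ⟨-1, neg_one_mem_rootsOfUnity_torsionOrder p⟩ * teichSign p ηN : ℤ) :
            ℤ_[p])) * (1 + PowerSeries.X) ^ sN.val * (Θ : PowerSeries ℤ_[p]) =
        (((cyclotomicOmega p n).map (Int.castRingHom ℤ_[p]) : ℤ_[p][X]) : PowerSeries ℤ_[p]) * q := by
  classical
  haveI := neZero_torsionOrder p
  haveI := Fintype.ofFinite (rootsOfUnity (torsionOrder p) ℤ_[p])
  let Bt : ZMod (p ^ n) → ℤ_[p] := fun s ↦ ⟨_, norm_coeffSum_le_one hp2 hf0 hQ hpN hap n s⟩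
  have hBt : ∀ s, ((Bt s : ℤ_[p]) : ℚ_[p]) = algebraMap ℚ ℚ_[p] (∑ w : rootsOfUnity (torsionOrder p) ℤ_[p],
      (teichSign p w : ℚ) * branchSymbol p f
        (((PadicInt.toZModPow (n + cyclotomicExponent p) ((w : ℤ_[p]ˣ) : ℤ_[p]) *
            (cyclotomicGenerator p : ZMod (p ^ (n + cyclotomicExponent p))) ^ s.val).val : ℚ) /
          (p : ℚ) ^ (n + cyclotomicExponent p))) := fun s ↦ rfl
  obtain ⟨Q, hQ'⟩ := cyclotomicOmega_dvd_reverse_sub_sign_mul_lift hp2 hσ hW n hν Bt hBt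
  obtain ⟨Q', hQ''⟩ := cyclotomicOmega_dvd_invol_sub_reverse (p := p) n Bt
  refine ⟨∑ s : ZMod (p ^ n), C (Bt s) * (X + 1) ^ s.val, Q' + (Q : PowerSeries ℤ_[p]),
    map_lift_eq_map_quadraticBranchMazurTateElement n Bt hBt, ?_⟩
  have h2 := congr_arg (fun P : ℤ_[p][X] ↦ (P : PowerSeries ℤ_[p])) hQ'
  simp only [Polynomial.coe_sub, Polynomial.coe_mul, Polynomial.coe_pow, Polynomial.coe_add, Polynomial.coe_X,
    Polynomial.coe_one, Polynomial.coe_C] at h2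
  rw [mul_add, ← h2, ← sub_add_cancel (invol p _) (((∑ s : ZMod (p ^ n), C (Bt s) * (X + 1) ^ (-s).val :
    ℤ_[p][X]) : PowerSeries ℤ_[p])), hQ'', add_comm (PowerSeries.X : PowerSeries ℤ_[p]) 1]
  ring

end Lambda


end Summit.BirchSwinnertonDyer.BirchSwinnertonDyer.Theorems.EtaThetaFunctionalEquation

end
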